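import Mathlib
import HarnessLib
import Summits.ResolutionOfSingularities.ResolutionOfSingularities.Theorems.WildQuotientsWildQuotientResolutionS1aPrincipalChartShrink
import Summits.ResolutionOfSingularities.ResolutionOfSingularities.Theorems.WildQuotientsWildQuotientResolutionS1aJInfHalves
import Summits.ResolutionOfSingularities.ResolutionOfSingularities.Theorems.WildQuotientsWildQuotientResolutionS1aKillCentreGood

/-!
# S1a — TRANSPORT OF `KillableAt` ACROSS THE IDLE REGION OF A MOVE; `jInf` does not increase under principal moves (modulo G1)

[OURS · L1 W4.5c · lead-1 g8; plan-1 SIG v3 `KillableAtOfIdle` / `JInfPrincipalMoveLe`, ASSIGNMENT v10.10 F4] — NOT statements of the manuscript; counted 0;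
AI-level work, weaker than expert review. Crux stmt-ResolutionOfSingularities-17941, line `s1a-logminvertex` v6. Route-independent.

* `ReesFiltration.comap` — pull-back of a Rees filtration along a morphism (Mathlib `IdealSheafData.comap`; multiplicativity by `comap_mul`);
* **`isPrincipalCentreChart_preimage`** — a principal-centre chart `O` of `(𝒦, d)` over which an equivariant `π' : V' → V` is an ISOMORPHISM pulls back to a
  principal-centre chart `π'⁻¹ O` of `(𝒦.comap π', d)` (same node, same centre; the section iso `π'.appLE` composed into `e`);
* **`GModel.killableAt_of_move_of_mem_support`** — along a move `π' : Mʼ → M` (blow-up of `𝒦.ideal d`): if `π' v'` lies OFF `supp(𝒦.ideal d)` and is killable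
  through a principal-centre chart `(𝒦₂, d₂, O₂)` with `π' v' ∈ supp(𝒦₂.ideal d₂)`, then `v'` is killable (shrink `O₂` into the idle region by
  `PrincipalChartShrink.exists_isPrincipalCentreChart_le`, pull back);
* `G1 p` — the SUPPORT LEMMA as a typed statement (OURS, to be discharged): a BAD point of a principal-centre chart of `(𝒦, d)` lies in `supp(𝒦.ideal d)`
  (off the support the kill clause at an invariant cover element exhibits a killed node through the point); with it:
  **`GModel.jInf_move_le_of_G1`** — `jInf Mʼ ≤ jInf M` for every move along a PRINCIPAL centre (`JInfPrincipalMoveLe` of SIG v3, modulo `G1`), whence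
  `killAlt_of_principalCentre_of_G1` and **`killOrAuxRuleJInf_of_principalCentreRule_of_G1`** (the one-phase rule implies the rule of record, modulo `G1`).
-/

set_option linter.dupNamespace false

noncomputable section

open CategoryTheory AlgebraicGeometry TopologicalSpace Topology
open Literature.AlgebraicGeometry.Resolution Literature.AlgebraicGeometry.RelativeSpec
open Summit.ResolutionOfSingularities.ResolutionOfSingularities.Theorems.WildQuotientResolution.S1
open Summit.ResolutionOfSingularities.ResolutionOfSingularities.Theorems.WildQuotientResolution.S1.NodeAtlas
open Summit.ResolutionOfSingularities.ResolutionOfSingularities.Theorems.WildQuotientResolution.S1.BlowupCharts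
open Summit.ResolutionOfSingularities.ResolutionOfSingularities.Theorems.WildQuotientResolution.S1.PrincipalChartShrink

namespace Summit.ResolutionOfSingularities.ResolutionOfSingularities.Theorems.WildQuotientResolution.S1.KillableTransport

universe u

/-! ## Pull-back of Rees filtrations -/

section PullbackRees

variable {V V' : Scheme.{u}}

/-- **Pull-back of a Rees filtration** along `π : V' ⟶ V` (piecewise `IdealSheafData.comap`; multiplicative by `comap_mul`). [OURS · L1 W4.5c] -/
def pullbackRees (𝒦 : ReesFiltration V) (π : V' ⟶ V) : ReesFiltration V' where
  ideal n := (𝒦.ideal n).comap π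
  ideal_zero := by rw [𝒦.ideal_zero, Scheme.IdealSheafData.comap_top]
  antitone m n h := Scheme.IdealSheafData.comap_mono π (𝒦.antitone h)
  mul_le m n := by
    rw [← comap_mul π (𝒦.ideal m) (𝒦.ideal n)]
    exact Scheme.IdealSheafData.comap_mono π (𝒦.mul_le m n)

/-- Pieces of the pull-back. -/
@[simp] theorem pullbackRees_ideal (𝒦 : ReesFiltration V) (π : V' ⟶ V) (n : ℕ) : (pullbackRees 𝒦 π).ideal n = (𝒦.ideal n).comap π := rfl

end PullbackRees

/-! ## Pulling a principal-centre chart back along an equivariant local isomorphism -/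

section Pullback

variable {V' V Y : Scheme.{u}} {q : V ⟶ Y} {r' : V' ⟶ Y} {G : Type u} [Group G] (ρ : ActionOver q G) (ρ' : ActionOver r' G)
  (π' : V' ⟶ V) (hr' : r' = π' ≫ q) (hcomm : ∀ g : G, (ρ'.aut g).hom ≫ π' = π' ≫ (ρ.aut g).hom) {p : ℕ} (g₀ : G)

include hcomm in
/-- The preimage of a `G`-stable open under an equivariant morphism is `G`-stable. -/
theorem preimage_stable (O : V.Opens) (hO : ∀ g : G, (ρ.aut g).hom ⁻¹ᵁ O = O) (g : G) : (ρ'.aut g).hom ⁻¹ᵁ (π' ⁻¹ᵁ O) = π' ⁻¹ᵁ O := by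
  rw [← Scheme.Hom.comp_preimage, hcomm g, Scheme.Hom.comp_preimage, hO]

include hr' hcomm in
/-- **The preimage of a stable open affine over the base, over which `π'` is an iso, as a stable open affine over the base.** -/
theorem exists_preimageStable (O : ρ.StableAffineOpens) (hO : IsAffineOpen O.1) [IsIso (π' ∣_ O.1)] :
    ∃ O' : ρ'.StableAffineOpens, O'.1 = π' ⁻¹ᵁ O.1 ∧ IsAffineOpen O'.1 := by
  haveI : IsAffineHom ((π' ⁻¹ᵁ O.1).ι ≫ r') := by
    rw [hr', ← Category.assoc, ← morphismRestrict_ι, Category.assoc]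
    haveI := O.2.2
    infer_instance
  have hO' : IsAffineOpen (π' ⁻¹ᵁ O.1) := by
    haveI : IsAffine (O.1 : Scheme.{u}) := hO
    exact IsAffine.of_isIso (π' ∣_ O.1)
  exact ⟨⟨π' ⁻¹ᵁ O.1, preimage_stable ρ ρ' π' hcomm O.1 O.2.1, inferInstance⟩, rfl, hO'⟩

include hr' hcomm in
/-- **A PRINCIPAL-CENTRE CHART PULLS BACK ALONG AN EQUIVARIANT MORPHISM WHICH IS AN ISOMORPHISM OVER IT**: `π'⁻¹ O` is a principal-centre chart of the
pulled-back filtration `(𝒦.comap π', d)`, with the same node and centre. [OURS · L1 W4.5c] -/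
theorem isPrincipalCentreChart_preimage (𝒦 : ReesFiltration V) (d : ℕ) (O : ρ.StableAffineOpens)
    (hkill : IsPrincipalCentreChart p ρ g₀ 𝒦 d O) [IsIso (π' ∣_ O.1)] :
    ∃ O' : ρ'.StableAffineOpens, O'.1 = π' ⁻¹ᵁ O.1 ∧ IsPrincipalCentreChart p ρ' g₀ (pullbackRees 𝒦 π') d O' := by
  obtain ⟨hO, m, r, B, _, 𝒜, _, σ, e, htame, hσ, c, f, δ, w, hc, hf, hw, hK1, hK1', hσJ, h𝒦, hver, hprin⟩ := hkill
  -- the new index `π'⁻¹ O`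
  have hstab : ∀ g : G, (ρ'.aut g).hom ⁻¹ᵁ (π' ⁻¹ᵁ O.1) = π' ⁻¹ᵁ O.1 := preimage_stable ρ ρ' π' hcomm O.1 O.2.1
  haveI : IsAffineHom ((π' ⁻¹ᵁ O.1).ι ≫ r') := by
    rw [hr', ← Category.assoc, ← morphismRestrict_ι, Category.assoc]
    haveI := O.2.2
    infer_instance
  have hO' : IsAffineOpen (π' ⁻¹ᵁ O.1) := by
    haveI : IsAffine (O.1 : Scheme.{u}) := hO
    exact IsAffine.of_isIso (π' ∣_ O.1)
  let O' : ρ'.StableAffineOpens := ⟨π' ⁻¹ᵁ O.1, hstab, inferInstance⟩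
  haveI hP : IsIso (π'.appLE O.1 (π' ⁻¹ᵁ O.1) le_rfl) := isIso_app_of_isIso_morphismRestrict O.1 inferInstance
  obtain ⟨P, hPapply⟩ : ∃ P : Γ(V, O.1) ≃+* Γ(V', π' ⁻¹ᵁ O.1), ∀ s, P s = π'.appLE O.1 (π' ⁻¹ᵁ O.1) le_rfl s :=
    ⟨(asIso (π'.appLE O.1 (π' ⁻¹ᵁ O.1) le_rfl)).commRingCatIsoToRingEquiv, fun _ => rfl⟩
  refine ⟨O', rfl, hO', m, r, B, inferInstance, 𝒜, inferInstance, σ, P.symm.trans e, htame, fun t => ?_, c, f, δ, w, hc, hf, hw, hK1, hK1', hσJ,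
    fun n => ?_, hver, hprin⟩
  · -- intertwining, transported along `P`
    obtain ⟨s, rfl⟩ := P.surjective t
    have h1 : (ρ'.aut g₀⁻¹).hom.appLE (π' ⁻¹ᵁ O.1) (π' ⁻¹ᵁ O.1) (hstab g₀⁻¹).ge (P s) =
        P ((ρ.aut g₀⁻¹).hom.appLE O.1 O.1 (O.2.1 g₀⁻¹).ge s) := by
      rw [hPapply, hPapply]
      exact appLE_comm_of_le ρ ρ' hcomm O.1 O.2.1 (π' ⁻¹ᵁ O.1) hstab le_rfl g₀⁻¹ s
    change e (P.symm ((ρ'.aut g₀⁻¹).hom.appLE (π' ⁻¹ᵁ O.1) (π' ⁻¹ᵁ O.1) (hstab g₀⁻¹).ge (P s))) = (σ (e (P.symm (P s))) : B)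
    rw [h1, P.symm_apply_apply, P.symm_apply_apply]
    exact hσ s
  · -- the filtration clause: `(pullbackRees 𝒦 π')(π'⁻¹O) = 𝒦(O) · Γ(π'⁻¹O)` and `P` is an iso
    rw [ReesFiltration.filtration_ideal, pullbackRees_ideal,
      ideal_comap_of_le π' (𝒦.ideal n) ⟨O.1, hO⟩ ⟨π' ⁻¹ᵁ O.1, hO'⟩ le_rfl, ← ReesFiltration.filtration_ideal, h𝒦 n]
    have hPhom : (π'.appLE O.1 (π' ⁻¹ᵁ O.1) le_rfl).hom = (P : Γ(V, O.1) →+* Γ(V', π' ⁻¹ᵁ O.1)) := RingHom.ext fun s => (hPapply s).symm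
    rw [hPhom, Ideal.map_comap_of_equiv]
    exact Ideal.ext fun _ => Iff.rfl

end Pullback

/-! ## Killability transports across the idle region of a move -/

section Move

variable {p : ℕ} {X' X₁ : Scheme.{0}} {q : X' ⟶ X₁} {G : Type} [Group G] {ρ : G →* Aut X'} {g₀ : G}

/-- **`KillableAt` TRANSPORTS ACROSS THE IDLE REGION OF A MOVE** (support form): along a move `π' : Mʼ → M` blowing up `𝒦.ideal d`, a point `v'` whose image
lies OFF the support of `𝒦.ideal d` and is killable through a principal-centre chart `(𝒦₂, d₂, O₂)` with `π' v' ∈ supp(𝒦₂.ideal d₂)` is killable.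
[OURS · L1 W4.5c] -/
theorem killableAt_of_move_of_mem_support [Finite G] (M M' : GameFrame.GModel p q G ρ g₀) (𝒦 : ReesFiltration M.V) (d : ℕ)
    (π' : M'.V ⟶ M.V) (hbl : IsBlowup π' (𝒦.ideal d)) (hr : M'.r = π' ≫ M.r)
    (hcomm : ∀ g : G, (M'.act.aut g).hom ≫ π' = π' ≫ (M.act.aut g).hom)
    (hsuppG : ∀ g : G, (M.act.aut g).hom ⁻¹ᵁ (𝒦.ideal d).support.compl = (𝒦.ideal d).support.compl)
    {v' : M'.V} (hv' : π'.base v' ∉ ((𝒦.ideal d).support : Set M.V))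
    {𝒦₂ : ReesFiltration M.V} {d₂ : ℕ} {O₂ : M.act.StableAffineOpens} (hO₂ : IsPrincipalCentreChart p M.act g₀ 𝒦₂ d₂ O₂) (hd₂ : 0 < d₂)
    (hvO₂ : π'.base v' ∈ O₂.1) (hvs : π'.base v' ∈ ((𝒦₂.ideal d₂).support : Set M.V)) : M'.KillableAt v' := by
  -- shrink `O₂` into the idle region of the move
  obtain ⟨O₃, hvO₃, -, hO₃W, hO₃, hO₃kill⟩ :=
    exists_isPrincipalCentreChart_le hO₂ hvO₂ hvs (𝒦.ideal d).support.compl hsuppG hv'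
  -- `π'` is an isomorphism over `O₃`
  have hdisj : Disjoint (O₃.1 : Set M.V) (𝒦.ideal d).support := by
    rw [Set.disjoint_iff]
    rintro x ⟨hx, hx'⟩
    exact hO₃W hx hx'
  haveI : IsIso (π' ∣_ O₃.1) := hbl.isIso_morphismRestrict hdisj
  obtain ⟨O₃', hO₃'eq, hkill'⟩ := isPrincipalCentreChart_preimage M.act M'.act π' hr hcomm g₀ 𝒦₂ d₂ O₃ hO₃kill
  refine ⟨pullbackRees 𝒦₂ π', d₂, O₃', hd₂, ?_, hkill'⟩
  rw [hO₃'eq]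
  exact hvO₃

/-! ## `jInf` under principal moves, modulo the support lemma G1 -/

/-- **G1 — THE SUPPORT LEMMA** (OURS, typed; to be discharged): on a model over a Noetherian base, a BAD point of a principal-centre chart of `(𝒦, d)` lies
in the support of `𝒦.ideal d`. (Off the support, the kill clause at an invariant cover element `b ∈ K_d` with `b(v) ≠ 0` exhibits a KILLED tame node through
`v` — Király–Lütkebohmert ⇒ `v` good.) [OURS · L1 W4.5c] -/
def G1 (p : ℕ) : Prop :=
  ∀ ⦃X' X₁ : Scheme.{0}⦄ (q : X' ⟶ X₁) (G : Type) [Group G] [Finite G] (ρ : G →* Aut X') (g₀ : G),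
    (∀ g : G, g ∈ Subgroup.zpowers g₀) →
    ∀ (M : GameFrame.GModel p q G ρ g₀) (𝒦 : ReesFiltration M.V) (d : ℕ) (O : M.act.StableAffineOpens),
      M.HasNoetherianBase → IsPrincipalCentreChart p M.act g₀ 𝒦 d O →
      ∀ v ∈ O.1, v ∈ M.badLocus → v ∈ ((𝒦.ideal d).support : Set M.V)

/-- The complement of the support of a `G`-stable ideal sheaf is `G`-stable. -/
theorem preimage_support_compl_of_comap_eq (M : GameFrame.GModel p q G ρ g₀) {I : M.V.IdealSheafData}
    (hI : ∀ g : G, I.comap (M.act.aut g).hom = I) (g : G) : (M.act.aut g).hom ⁻¹ᵁ I.support.compl = I.support.compl := by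
  ext x
  change (M.act.aut g).hom.base x ∈ ((I.support : Set M.V))ᶜ ↔ x ∈ ((I.support : Set M.V))ᶜ
  rw [Set.mem_compl_iff, Set.mem_compl_iff, not_iff_not]
  have h := congrArg (fun J : M.V.IdealSheafData => ((J.support : Set M.V))) (hI g)
  simp only [Scheme.IdealSheafData.support_comap, TopologicalSpace.Closeds.coe_preimage] at h
  exact (Set.ext_iff.mp h x)

/-- **THE NON-KILLABLE LOCUS OF A PRINCIPAL MOVE EMBEDS INTO THAT OF THE BASE, modulo G1.** [OURS · L1 W4.5c] -/
theorem exists_isInducing_nonKillable_of_G1 [Finite G] (hG1 : G1 p) (hp : p.Prime) (hG : ∀ g : G, g ∈ Subgroup.zpowers g₀)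
    (M M' : GameFrame.GModel p q G ρ g₀) (𝒦 : ReesFiltration M.V) (d : ℕ) (hprin : IsPrincipalCentre p M.act g₀ 𝒦 d) (hB : M.HasNoetherianBase)
    (π' : M'.V ⟶ M.V) (hbl : IsBlowup π' (𝒦.ideal d)) (hr : M'.r = π' ≫ M.r) (hcomm : ∀ g : G, (M'.act.aut g).hom ≫ π' = π' ≫ (M.act.aut g).hom) :
    ∃ ψ : ↥M'.nonKillable → ↥M.nonKillable, IsInducing ψ := by
  obtain ⟨R₀, _, _, s, _, hs⟩ := id hB
  have hsuppG := fun g => preimage_support_compl_of_comap_eq M (I := 𝒦.ideal d) (fun g => hprin.2.1 g d) g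
  let W : M.V.Opens := (𝒦.ideal d).support.compl
  -- bad points of `Mʼ` lie over the idle region `W`
  have hW : ∀ v' : ↥M'.nonKillable, v'.1 ∈ π' ⁻¹ᵁ W := fun v' => by
    obtain ⟨hbad, hno⟩ := GameFrame.GModel.mem_badLocus_of_principalMove hp hG M M' 𝒦 d hprin π' hbl hr hcomm s hs v'.2.1
    obtain ⟨O, hvO, hO | hO⟩ := hprin.2.2 (π'.base v'.1)
    · exact absurd hvO (hno O hO)
    · change π'.base v'.1 ∈ ((𝒦.ideal d).support : Set M.V)ᶜ
      exact Set.disjoint_left.mp (disjoint_support_of_ideal_eq_top (I := 𝒦.ideal d) hO.1.1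
        (by rw [← ReesFiltration.filtration_ideal]; exact hO.2 d)) hvO
  -- and map to non-killable points of `M` (this is where G1 enters)
  have key : ∀ v' : ↥M'.nonKillable, π'.base v'.1 ∈ M.nonKillable := fun v' => by
    obtain ⟨hbad, -⟩ := GameFrame.GModel.mem_badLocus_of_principalMove hp hG M M' 𝒦 d hprin π' hbl hr hcomm s hs v'.2.1
    refine ⟨hbad, fun ⟨𝒦₂, d₂, O₂, hd₂, hvO₂, hO₂⟩ => v'.2.2 ?_⟩
    have hvs : π'.base v'.1 ∈ ((𝒦₂.ideal d₂).support : Set M.V) := hG1 q G ρ g₀ hG M 𝒦₂ d₂ O₂ hB hO₂ _ hvO₂ hbad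
    exact killableAt_of_move_of_mem_support M M' 𝒦 d π' hbl hr hcomm hsuppG (hW v') hO₂ hd₂ hvO₂ hvs
  -- `π'` is an isomorphism over `W`; the embedding factors through it
  haveI hiso : IsIso (π' ∣_ W) := hbl.isIso_morphismRestrict (U := W) (by
    rw [Set.disjoint_iff]; rintro x ⟨hx, hx'⟩; exact hx hx')
  let e : ↥(π' ⁻¹ᵁ W) ≃ₜ ↥W := Scheme.homeoOfIso (asIso (π' ∣_ W))
  let φ₀ : ↥M'.nonKillable → M.V := fun v' => ((e ⟨v'.1, hW v'⟩ : ↥W) : M.V)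
  have hφ₀ : ∀ v', φ₀ v' = π'.base v'.1 := fun v' => by
    have h1 : (e ⟨v'.1, hW v'⟩ : ↥W) = (π' ∣_ W).base ⟨v'.1, hW v'⟩ := rfl
    change ((e ⟨v'.1, hW v'⟩ : ↥W) : M.V) = _
    rw [h1]
    exact morphismRestrict_base_coe π' W ⟨v'.1, hW v'⟩
  have hind₀ : IsInducing φ₀ := by
    refine IsInducing.subtypeVal.comp (e.isInducing.comp ?_)
    exact (IsInducing.subtypeVal.codRestrict hW : IsInducing fun v' : ↥M'.nonKillable => (⟨v'.1, hW v'⟩ : ↥(π' ⁻¹ᵁ W)))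
  have hmem₀ : ∀ v', φ₀ v' ∈ M.nonKillable := fun v' => by rw [hφ₀]; exact key v'
  exact ⟨Set.codRestrict φ₀ _ hmem₀, hind₀.codRestrict hmem₀⟩

/-- **`jInf` DOES NOT INCREASE UNDER A PRINCIPAL MOVE, modulo G1** (`JInfPrincipalMoveLe` of SIG v3). [OURS · L1 W4.5c] -/
theorem jInf_move_le_of_G1 [Finite G] (hG1 : G1 p) (hp : p.Prime) (hG : ∀ g : G, g ∈ Subgroup.zpowers g₀) (M M' : GameFrame.GModel p q G ρ g₀)
    (𝒦 : ReesFiltration M.V) (d : ℕ) (hprin : IsPrincipalCentre p M.act g₀ 𝒦 d) (hB : M.HasNoetherianBase) (hmv : M.IsMoveOf M' 𝒦 d) :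
    M'.jInf ≤ M.jInf := by
  obtain ⟨π', hbl, -, hr, hcomm⟩ := hmv
  obtain ⟨ψ, hψ⟩ := exists_isInducing_nonKillable_of_G1 hG1 hp hG M M' 𝒦 d hprin hB π' hbl hr hcomm
  exact hψ.topologicalKrullDim_le

/-- **Modulo G1, a principal centre meeting every bad component IS a KILL alternative of the rule of record.** [OURS · L1 W4.5c] -/
theorem killAlt_of_principalCentre_of_G1 [Finite G] (hG1 : G1 p) (hp : p.Prime) (hG : ∀ g : G, g ∈ Subgroup.zpowers g₀)
    (M : GameFrame.GModel p q G ρ g₀) (hB : M.HasNoetherianBase) {𝒦 : ReesFiltration M.V} {d : ℕ} (hprin : IsPrincipalCentre p M.act g₀ 𝒦 d)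
    (hhit : ∀ t ∈ irreducibleComponents ↥M.badLocus, ∃ x ∈ t, (x : M.V) ∈ M.principalKillOpen 𝒦 d) :
    ∃ (𝒦 : ReesFiltration M.V) (d : ℕ), IsPrincipalCentre p M.act g₀ 𝒦 d ∧
      (∀ t ∈ irreducibleComponents ↥M.badLocus, ∃ x ∈ t, (x : M.V) ∈ M.principalKillOpen 𝒦 d) ∧
      ∀ M' : GameFrame.GModel p q G ρ g₀, M.IsMoveOf M' 𝒦 d → M'.jInf ≤ M.jInf :=
  ⟨𝒦, d, hprin, hhit, fun M' hmv => jInf_move_le_of_G1 hG1 hp hG M M' 𝒦 d hprin hB hmv⟩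

/-- **Modulo G1, the one-phase rule implies the rule of record** (`PrincipalCentreRule p → KillOrAuxRuleJInf p`): every KILL of the one-phase rule keeps
`jInf` from increasing. [OURS · L1 W4.5c] -/
theorem killOrAuxRuleJInf_of_principalCentreRule_of_G1 (hG1 : G1 p) (hp : p.Prime) (hrule : PrincipalCentreRule p) : KillOrAuxRuleJInf p := by
  intro X' X₁ q G _ _ ρ g₀ hG M hB hT
  obtain ⟨𝒦, d, hprin, hhit⟩ := hrule q G ρ g₀ hG M hB hT
  refine Or.inl (killAlt_of_principalCentre_of_G1 hG1 hp hG M hB hprin fun t ht => ?_)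
  obtain ⟨x, hxt, O, hO, hxO⟩ := hhit t ht
  exact ⟨x, hxt, Set.mem_iUnion.mpr ⟨O, Set.mem_iUnion.mpr ⟨hO, hxO⟩⟩⟩

end Move

end Summit.ResolutionOfSingularities.ResolutionOfSingularities.Theorems.WildQuotientResolution.S1.KillableTransport

end
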